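import Summits.PneNP.PneNP.Theorems.ChebyshevTracialDesignVirtualNonnegSpread
import HarnessLib

/-!
# Cell pnp-psdrank, route `ChebyshevTracialDesign`: the r = 1 degree-truncation theorem and the spread-cell value bound on HALF slices
# (`2t ≤ n`, including `t = n/2`) — the form needed by the reduced instances of the non-tight-free rung

Harmonic backbone of the crux `TracialDecayExp20` (stmt-PneNP-19878), brick 47 (prover g10; input of NTF mod KL). Brick 19
(`…ProfileExtrapolation.rectangle_value_truncation_explicit`) and brick 46 (`…VirtualNonnegSpread.spreadCell_value_le_of_globalLevelD`) take
an `IsExactDesign`, whose side condition `2t + 2 ≤ n` comes from the SHARP level attenuation (eng g8 `kernelEigen_level_le_sharp`). In the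
non-tight-free `r = 1` rung (NTF) a Kupavskii–Zakharov piece with core `S` (`|S| = s`) and a non-crossing pattern `π` (the union of `p₁` edges
of `S`, the other `p₂ = s − p₁` edges outside the cut) lives in the reduced instance `K_m`, `m = n − 2s`, with cut size `t'' = t − 2p₁`; when
`p₂ − p₁ = n/2 − t` one gets `t'' = m/2` EXACTLY (after complementing too), which `2t''+2 ≤ m` excludes. This file re-derives the two
statements from the UNCONDITIONAL attenuation (brick 13 `…LevelTail.kernelEigen_level_le_of_lt_uncond`, valid for `2t ≤ n`) at the price
of the explicit factor `G_m = (1 + 2m(2m+1)/(4(c'−m+1)(n/2−c'−m)))^{c'}` (level `2m+1`) in the tail: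
* §1 `weighted_profile_polynomial_half` — the level profile of a weighted rectangle is a polynomial of degree `≤ D` up to `|Q_c|·√(G_m²·P_D·μ·ν)`;
* §2 `rectangle_value_truncation_half` — for explicit design data (`T ≤ t`, odd levels `3 ≤ c ≤ T` with nonempty classes, exactness of degree
  `D`, `Σ|w_c| ≤ B`) and a bound `Γ ≥ G_{(c−1)/2}` on the used levels: `|V(X × Y) + Virt| ≤ B·Γ·√(P_D μ ν)`;
* §3 **`spreadCell_value_le_half_of_globalLevelD`** — under `GlobalLevelDInequality`: for even `n ≥ n₁`, `t = 2c'+1` with `2t ≤ n ≤ 5t`, such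
  design data with `D + 2 ≤ 2c'`, `D ≤ 2(dq n + 8)`, a family `A` of `t`-cuts and a `(PM_n,τ)`-homogeneous `Y`, both of density `≥ exp(−c₀ dq n)`:
  `Σ_{U∈A} Σ_{M∈Y} W(U,M) ≤ B·Γ·√(P_D·μ·ν)` (brick 45 `virtual_rectangle_ge` + brick 46 `head_layerBound_of_globalLevelD` + §2).
[cite: Rothvoss2017, §2 (PDF p. 6)] [cite: Grigoriev2001, Lemma 1.4 (PDF p. 8)] [cite: KeevashLifshitz2023, Thm. 1.8] [cite: BrouwerHaemers2012, Prop. 4.3.2 (PDF p. 83)]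
Stature: support/instrument, §3 CONDITIONAL on `GlobalLevelDInequality` (binder only). WHAT THIS IS NOT: not NTF, not the crux, nothing on psd rank,
no P-vs-NP content. Supports stmt-PneNP-19878.
-/

set_option linter.dupNamespace false -- `Summit.PneNP.PneNP.…`: summit = sub-problem (D-0017)

noncomputable section

namespace Summit.PneNP.PneNP.Theorems.ChebyshevTracialDesignProfileExtrapolationHalf

open Finset Polynomial Literature.Barriers.PneNP Literature.Combinatorics.Optimization Literature.Computability.Complexity
open Literature.Combinatorics.SimpleGraph.CycleSpace
open Literature.Combinatorics.AssociationSchemes Literature.Combinatorics.AssociationSchemes.JohnsonHarmonics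
open Literature.Combinatorics.AssociationSchemes.JohnsonSpectrum
open Literature.Combinatorics.SetFamily
open Literature.Combinatorics.Additive.KeevashLifshitz
open Summit.PneNP.PneNP.Theorems.ChebyshevTracialDesignTightColumnSums
open Summit.PneNP.PneNP.Theorems.ChebyshevTracialDesignTightFreeSpectral
open Summit.PneNP.PneNP.Theorems.ChebyshevTracialDesignLevelTail
open Summit.PneNP.PneNP.Theorems.ChebyshevTracialDesignLevelNormalisation
open Summit.PneNP.PneNP.Theorems.ChebyshevTracialDesignProfilePolynomial
open Summit.PneNP.PneNP.Theorems.ChebyshevTracialDesignProfileExtrapolation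
open Summit.PneNP.PneNP.Theorems.ChebyshevTracialDesignVirtualBimode
open Summit.PneNP.PneNP.Theorems.ChebyshevTracialDesignVirtualNonnegSpread

variable {n : ℕ}

/-! ### §1 The profile polynomial on a half slice -/

/-- **The level profile of a weighted rectangle is a polynomial, half-slice form.** For `n` even, `t = 2c'+1` with `2t ≤ n` (equality allowed),
`D ≤ 2c'`, `f` on the `t`-subsets with harmonic layer decomposition `p`, and ANY weights `y`, there is a real polynomial `P` of degree `≤ D` with
`P(0) = (1/|PM|)·Σ_M y(M)·Ẽ_M[f_{≤D}]` and, for every `m ≤ c'`,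
`|Σ_M y(M)·Σ_{|U|=t} f(U)·1[#cr(U,M) = 2m+1] − |Q_{2m+1}|·P(2m+1)| ≤ |Q_{2m+1}|·√(G_m²·P_D·(Σf²/C(n,t))·(Σy²/|PM|))`,
`G_m = (1 + 2m(2m+1)/(4(c'−m+1)(n/2−c'−m)))^{c'}`. [cite: Rothvoss2017, §2 (PDF p. 6)] [cite: Grigoriev2001, Lemma 1.4 (PDF p. 8)]
[cite: BrouwerHaemers2012, Prop. 4.3.2 (PDF p. 83)] -/
theorem weighted_profile_polynomial_half {c' D : ℕ} (hn : Even n) (ht : 2 * (2 * c' + 1) ≤ n) (hD : D ≤ 2 * c')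
    (f : Finset (Fin n) → ℝ) (p : ℕ → Finset (Fin n) → ℝ) (hp : ∀ j, IsHarmonic j (p j))
    (hdec : ∀ U ∈ univ.powersetCard (2 * c' + 1), f U = (∑ j ∈ range (2 * c' + 1 + 1), up^[2 * c' + 1 - j] (p j)) U)
    (y : PMatch n → ℝ) :
    ∃ P : Polynomial ℝ, P.natDegree ≤ D ∧
      P.eval 0 = (Fintype.card (PMatch n) : ℝ)⁻¹ * ∑ M : PMatch n, y M *
        ∑ A : {A : Finset (Fin n) // A.card ≤ D},
          (∑ j ∈ range (2 * c' + 1 + 1), ((2 * c' + 1 - j).factorial : ℝ) • (if D < j then 0 else p j)) A.1 *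
            knapsackMoment M.1.card (((2 * c' + 1 : ℕ) : ℝ) / 2) (M.1.filter fun e => ∃ a ∈ A.1, a ∈ e).card ∧
      ∀ m : ℕ, m ≤ c' →
        |∑ M : PMatch n, y M * ∑ U ∈ univ.powersetCard (2 * c' + 1),
              f U * (if (U.filter fun x => M.2.partner x ∉ U).card = 2 * m + 1 then (1 : ℝ) else 0) -
            ((Qset n (2 * c' + 1) (2 * m + 1)).card : ℝ) * P.eval ((2 * m + 1 : ℕ) : ℝ)| ≤
          ((Qset n (2 * c' + 1) (2 * m + 1)).card : ℝ) *
            Real.sqrt ((((1 + (2 * m * (2 * m + 1) : ℝ) / (4 * (c' - m + 1) * ((n / 2 - c' - m : ℕ) : ℝ))) ^ c') ^ 2 *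
                ∏ i ∈ range (D / 2 + 1), ((2 * i + 1 : ℝ) / ((n : ℝ) - 2 * i))) *
              ((∑ U ∈ univ.powersetCard (2 * c' + 1), f U ^ 2) / (n.choose (2 * c' + 1) : ℝ)) *
              ((∑ M : PMatch n, y M ^ 2) / (Fintype.card (PMatch n) : ℝ))) := by
  classical
  have htodd : Odd (2 * c' + 1) := ⟨c', rfl⟩
  have htn : 2 * (2 * c' + 1) ≤ n + 1 := by omega
  set q : Finset (Fin n) → ℝ :=
    ∑ j ∈ range (2 * c' + 1 + 1), ((2 * c' + 1 - j).factorial : ℝ) • (if D < j then 0 else p j) with hq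
  obtain ⟨U₀, hU₀⟩ : ∃ U : Finset (Fin n), U ∈ univ.powersetCard (2 * c' + 1) := by
    have : (univ.powersetCard (2 * c' + 1) : Finset (Finset (Fin n))).Nonempty := by
      apply powersetCard_nonempty.2; rw [card_univ, Fintype.card_fin]; omega
    exact this
  have hq0 : ∀ A : Finset (Fin n), D < A.card → q A = 0 :=
    fun A hA => (lowPart_apply_eq_zeta D p hp (mem_powersetCard.1 hU₀).2).2 A hA
  obtain ⟨P, hPdeg, hP0, hPval⟩ := exists_weighted_levelPoly_zeta (D := D) htodd y q hq0
  have hPm : (0 : ℝ) < Fintype.card (PMatch n) := by exact_mod_cast card_pmatch_pos hn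
  have hCn : (0 : ℝ) < n.choose (2 * c' + 1) := by exact_mod_cast Nat.choose_pos (by omega)
  refine ⟨C ((Fintype.card (PMatch n) : ℝ)⁻¹) * P, (natDegree_C_mul_le _ _).trans hPdeg, ?_, fun m hmc => ?_⟩
  · rw [eval_mul, eval_C, hP0]
  · obtain ⟨κm, hAm⟩ := exists_levelGram_classFunction (n := n) htodd (2 * m + 1)
    have hl0 := kernelEigen_level_zero_nonneg ht κm hAm
    have hPD := prod_atten_nonneg (n := n) (K := D) (by omega)
    set G : ℝ := ((1 + (2 * m * (2 * m + 1) : ℝ) / (4 * (c' - m + 1) * ((n / 2 - c' - m : ℕ) : ℝ))) ^ c') ^ 2 with hG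
    have hG0 : 0 ≤ G := sq_nonneg _
    have hΛ : ∀ j, D < j → j ≤ 2 * c' + 1 → kernelEigen n (2 * c' + 1) j κm ≤
        kernelEigen n (2 * c' + 1) 0 κm * (G * ∏ i ∈ range (D / 2 + 1), ((2 * i + 1 : ℝ) / ((n : ℝ) - 2 * i))) := by
      intro j hDj hjt
      have h := kernelEigen_level_le_of_lt_uncond hn ht hmc (by omega) κm hAm hDj hjt
      rw [← mul_assoc]; exact h
    have hci : 2 * m + 1 + 2 * (c' - m) = 2 * c' + 1 := by omega
    have hmain := weighted_level_sum_sub_poly_le (K := D) htn y f p hp hdec P hPval hci κm hAm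
      (mul_nonneg hl0 (mul_nonneg hG0 hPD)) hΛ
    have hQ := card_Qset_eq (n := n) hmc
    have hlam := kernelEigen_level_zero_eq ht hmc κm hAm
    have hNeq : (((n / 2).choose (2 * m + 1 + (c' - m)) * (2 * m + 1 + (c' - m)).choose (c' - m) *
          2 ^ (2 * m + 1) : ℕ) : ℝ) * P.eval ((2 * m + 1 : ℕ) : ℝ) =
        ((Qset n (2 * c' + 1) (2 * m + 1)).card : ℝ) *
          (C ((Fintype.card (PMatch n) : ℝ)⁻¹) * P).eval ((2 * m + 1 : ℕ) : ℝ) := by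
      rw [eval_mul, eval_C, hQ]
      field_simp
    have htail := sqrt_tail_eq (G * ∏ i ∈ range (D / 2 + 1), ((2 * i + 1 : ℝ) / ((n : ℝ) - 2 * i)))
      (∑ U ∈ univ.powersetCard (2 * c' + 1), f U ^ 2) (∑ M : PMatch n, y M ^ 2) hPm hCn (Nat.cast_nonneg _) hQ hlam
    rw [← hNeq, ← htail]
    exact hmain

/-! ### §2 The value truncation on a half slice, for explicit design data -/

/-- **The r = 1 degree-truncation theorem on a half slice (0/1 rectangles, explicit design data).** For `n` even, `t = 2c'+1` with `2t ≤ n`,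
levels `C` (odd, `3 ≤ c ≤ T ≤ t`, nonempty classes) and weights `w` exact at degree `D ≤ 2c'` (`Σ_c w_c p(c) = −p(0)` for `deg p ≤ D`) with
`Σ|w_c| ≤ B`, a bound `Γ` with `G_{(c−1)/2} ≤ Γ` on the levels of `C`, a family `X` of `t`-subsets (harmonic layers `p`) and any set `Y` of perfect
matchings: `|Σ_U Σ_{M∈Y} W(U,M)·1_X(U) + Virt| ≤ B·Γ·√(P_D·μ(X)·ν(Y))`. [cite: Rothvoss2017, §2 (PDF p. 6)] [cite: Grigoriev2001, Lemma 1.4 (PDF p. 8)] -/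
theorem rectangle_value_truncation_half {c' T D : ℕ} {Bv Γ : ℝ} {C : Finset ℕ} {w : ℕ → ℝ} (hn : Even n)
    (ht : 2 * (2 * c' + 1) ≤ n) (hTt : T ≤ 2 * c' + 1) (hD : D ≤ 2 * c')
    (hC : ∀ c ∈ C, Odd c ∧ 3 ≤ c ∧ c ≤ T ∧ (Qset n (2 * c' + 1) c).Nonempty)
    (hexact : ∀ q : Polynomial ℝ, q.natDegree ≤ D → ∑ c ∈ C, w c * q.eval (c : ℝ) = -q.eval 0)
    (hB : ∑ c ∈ C, |w c| ≤ Bv) (hΓ0 : 0 ≤ Γ)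
    (hΓ : ∀ m : ℕ, 2 * m + 1 ≤ T →
      (1 + (2 * m * (2 * m + 1) : ℝ) / (4 * (c' - m + 1) * ((n / 2 - c' - m : ℕ) : ℝ))) ^ c' ≤ Γ)
    (X : Finset (Finset (Fin n))) (hX : X ⊆ univ.powersetCard (2 * c' + 1)) (Y : Finset (PMatch n))
    (p : ℕ → Finset (Fin n) → ℝ) (hp : ∀ j, IsHarmonic j (p j))
    (hdec : ∀ U ∈ univ.powersetCard (2 * c' + 1),
      (if U ∈ X then (1 : ℝ) else 0) = (∑ j ∈ range (2 * c' + 1 + 1), up^[2 * c' + 1 - j] (p j)) U) :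
    |∑ U : OddSet n, ∑ M ∈ Y, levelWeight n (2 * c' + 1) C w U M * (if U.1 ∈ X then (1 : ℝ) else 0) +
        (Fintype.card (PMatch n) : ℝ)⁻¹ * ∑ M ∈ Y,
          ∑ A : {A : Finset (Fin n) // A.card ≤ D},
            (∑ j ∈ range (2 * c' + 1 + 1), ((2 * c' + 1 - j).factorial : ℝ) • (if D < j then 0 else p j)) A.1 *
              knapsackMoment M.1.card (((2 * c' + 1 : ℕ) : ℝ) / 2) (M.1.filter fun e => ∃ a ∈ A.1, a ∈ e).card| ≤
      Bv * Γ * Real.sqrt ((∏ i ∈ range (D / 2 + 1), ((2 * i + 1 : ℝ) / ((n : ℝ) - 2 * i))) *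
        ((X.card : ℝ) / (n.choose (2 * c' + 1) : ℝ)) * ((Y.card : ℝ) / (Fintype.card (PMatch n) : ℝ))) := by
  classical
  set fX : Finset (Fin n) → ℝ := fun U => if U ∈ X then (1 : ℝ) else 0 with hfX
  set yY : PMatch n → ℝ := fun M => if M ∈ Y then (1 : ℝ) else 0 with hyY
  obtain ⟨P, hPdeg, hP0, hPlev⟩ := weighted_profile_polynomial_half hn ht hD fX p hp hdec yY
  have hPm : (0 : ℝ) < Fintype.card (PMatch n) := by exact_mod_cast card_pmatch_pos hn
  have hCn : (0 : ℝ) < n.choose (2 * c' + 1) := by exact_mod_cast Nat.choose_pos (by omega)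
  have hPD := prod_atten_nonneg (n := n) (K := D) (by omega)
  set τ : ℝ := Real.sqrt ((∏ i ∈ range (D / 2 + 1), ((2 * i + 1 : ℝ) / ((n : ℝ) - 2 * i))) *
    ((X.card : ℝ) / (n.choose (2 * c' + 1) : ℝ)) * ((Y.card : ℝ) / (Fintype.card (PMatch n) : ℝ))) with hτ
  have hτ0 : 0 ≤ τ := Real.sqrt_nonneg _
  -- norms of the indicators
  have hfX2 : ∑ U ∈ univ.powersetCard (2 * c' + 1), fX U ^ 2 = (X.card : ℝ) := sum_boole_sq_of_subset hX
  have hyY2 : ∑ M : PMatch n, yY M ^ 2 = (Y.card : ℝ) := sum_boole_sq_of_subset (subset_univ Y)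
  -- Γ is nonnegative (from any used level or trivially if `C` is empty we only need it under `|w c|`)
  have hΓm : ∀ c ∈ C, ∀ m : ℕ, c = 2 * m + 1 →
      0 ≤ (1 + (2 * m * (2 * m + 1) : ℝ) / (4 * (c' - m + 1) * ((n / 2 - c' - m : ℕ) : ℝ))) ^ c' ∧
      (1 + (2 * m * (2 * m + 1) : ℝ) / (4 * (c' - m + 1) * ((n / 2 - c' - m : ℕ) : ℝ))) ^ c' ≤ Γ := by
    intro c hc m hm
    refine ⟨pow_nonneg (add_nonneg zero_le_one (div_nonneg (by positivity) ?_)) _, hΓ m (by rw [← hm]; exact (hC c hc).2.2.1)⟩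
    have : (0 : ℝ) ≤ (c' : ℝ) - m + 1 := by
      have : m ≤ c' := by have := (hC c hc).2.2.1; omega
      have : (m : ℝ) ≤ c' := by exact_mod_cast this
      linarith
    positivity
  -- the level sums
  set L : ℕ → ℝ := fun c => ∑ M : PMatch n, yY M * ∑ U ∈ univ.powersetCard (2 * c' + 1),
    fX U * (if (U.filter fun x => M.2.partner x ∉ U).card = c then (1 : ℝ) else 0) with hL
  have hval : ∑ U : OddSet n, ∑ M ∈ Y, levelWeight n (2 * c' + 1) C w U M * (if U.1 ∈ X then (1 : ℝ) else 0) =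
      ∑ c ∈ C, w c / ((Qset n (2 * c' + 1) c).card : ℝ) * L c := by
    have h1 : ∑ U : OddSet n, ∑ M ∈ Y, levelWeight n (2 * c' + 1) C w U M * (if U.1 ∈ X then (1 : ℝ) else 0) =
        ∑ U : OddSet n, ∑ M : PMatch n, levelWeight n (2 * c' + 1) C w U M * (fX U.1 * yY M) := by
      refine sum_congr rfl fun U _ => ?_
      rw [← sum_boole_mul_univ Y]
      exact sum_congr rfl fun M _ => by simp only [hfX, hyY]; ring
    rw [h1, value_eq_level_sums]
    exact sum_congr rfl fun c _ => by rw [level_sum_product_eq ⟨c', rfl⟩ c fX yY]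
  -- per level
  have hlev : ∀ c ∈ C, |w c / ((Qset n (2 * c' + 1) c).card : ℝ) * L c - w c * P.eval (c : ℝ)| ≤ |w c| * (Γ * τ) := by
    intro c hc
    obtain ⟨⟨m, hm⟩, -, hcT, hne⟩ := hC c hc
    have hmc : m ≤ c' := by omega
    obtain ⟨hG0, hGΓ⟩ := hΓm c hc m hm
    have hQpos : (0 : ℝ) < ((Qset n (2 * c' + 1) c).card : ℝ) := by exact_mod_cast card_pos.2 hne
    have h1 : |L c - ((Qset n (2 * c' + 1) c).card : ℝ) * P.eval (c : ℝ)| ≤ ((Qset n (2 * c' + 1) c).card : ℝ) * (Γ * τ) := by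
      have h0 := hPlev m hmc
      rw [← hm, hfX2, hyY2] at h0
      refine (by simpa only [hL] using h0 : |L c - ((Qset n (2 * c' + 1) c).card : ℝ) * P.eval (c : ℝ)| ≤ _).trans ?_
      refine mul_le_mul_of_nonneg_left ?_ hQpos.le
      rw [show (((1 + (2 * m * (2 * m + 1) : ℝ) / (4 * (c' - m + 1) * ((n / 2 - c' - m : ℕ) : ℝ))) ^ c') ^ 2 *
            ∏ i ∈ range (D / 2 + 1), ((2 * i + 1 : ℝ) / ((n : ℝ) - 2 * i))) *
          ((X.card : ℝ) / (n.choose (2 * c' + 1) : ℝ)) * ((Y.card : ℝ) / (Fintype.card (PMatch n) : ℝ)) =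
          ((1 + (2 * m * (2 * m + 1) : ℝ) / (4 * (c' - m + 1) * ((n / 2 - c' - m : ℕ) : ℝ))) ^ c') ^ 2 *
          ((∏ i ∈ range (D / 2 + 1), ((2 * i + 1 : ℝ) / ((n : ℝ) - 2 * i))) *
          ((X.card : ℝ) / (n.choose (2 * c' + 1) : ℝ)) * ((Y.card : ℝ) / (Fintype.card (PMatch n) : ℝ))) by ring,
        Real.sqrt_mul (sq_nonneg _), Real.sqrt_sq hG0]
      exact mul_le_mul_of_nonneg_right hGΓ hτ0
    have heq : w c / ((Qset n (2 * c' + 1) c).card : ℝ) * L c - w c * P.eval (c : ℝ) =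
        w c / ((Qset n (2 * c' + 1) c).card : ℝ) * (L c - ((Qset n (2 * c' + 1) c).card : ℝ) * P.eval (c : ℝ)) := by
      field_simp
    rw [heq, abs_mul, abs_div, Nat.abs_cast]
    calc |w c| / ((Qset n (2 * c' + 1) c).card : ℝ) * |L c - ((Qset n (2 * c' + 1) c).card : ℝ) * P.eval (c : ℝ)|
        ≤ |w c| / ((Qset n (2 * c' + 1) c).card : ℝ) * (((Qset n (2 * c' + 1) c).card : ℝ) * (Γ * τ)) :=
          mul_le_mul_of_nonneg_left h1 (div_nonneg (abs_nonneg _) hQpos.le)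
      _ = |w c| * (Γ * τ) := by field_simp
  -- `P(0)` is the virtual term
  have hP0' : P.eval 0 = (Fintype.card (PMatch n) : ℝ)⁻¹ * ∑ M ∈ Y,
      ∑ A : {A : Finset (Fin n) // A.card ≤ D},
        (∑ j ∈ range (2 * c' + 1 + 1), ((2 * c' + 1 - j).factorial : ℝ) • (if D < j then 0 else p j)) A.1 *
          knapsackMoment M.1.card (((2 * c' + 1 : ℕ) : ℝ) / 2) (M.1.filter fun e => ∃ a ∈ A.1, a ∈ e).card := by
    rw [hP0, sum_boole_mul_univ Y]
  have hsum : ∑ U : OddSet n, ∑ M ∈ Y, levelWeight n (2 * c' + 1) C w U M * (if U.1 ∈ X then (1 : ℝ) else 0) + P.eval 0 =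
      ∑ c ∈ C, (w c / ((Qset n (2 * c' + 1) c).card : ℝ) * L c - w c * P.eval (c : ℝ)) := by
    rw [hval, sum_sub_distrib, hexact P hPdeg]
    ring
  rw [← hP0', hsum]
  calc |∑ c ∈ C, (w c / ((Qset n (2 * c' + 1) c).card : ℝ) * L c - w c * P.eval (c : ℝ))|
      ≤ ∑ c ∈ C, |w c| * (Γ * τ) := (abs_sum_le_sum_abs _ _).trans (sum_le_sum hlev)
    _ = (∑ c ∈ C, |w c|) * (Γ * τ) := by rw [sum_mul]
    _ ≤ Bv * (Γ * τ) := mul_le_mul_of_nonneg_right hB (mul_nonneg hΓ0 hτ0)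
    _ = Bv * Γ * τ := by ring

/-! ### §3 The design value of a dense spread cell on a half slice -/

/-- **THE DESIGN VALUE OF A DENSE SPREAD CELL, half-slice form (mod KL).** Under `GlobalLevelDInequality`, for every `τ ≥ 1` there are
`c₀ ∈ (0,1]`, `n₁` such that: for even `n ≥ n₁`, `t = 2c'+1` with `2t ≤ n ≤ 5t` (equality `2t = n` allowed), explicit design data
(`T ≤ t`, odd levels `3 ≤ c ≤ T` with nonempty classes, exactness of degree `D`, `Σ|w_c| ≤ B`) with `D + 2 ≤ 2c'`, `D ≤ 2(dq n + 8)`, a bound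
`Γ ≥ G_{(c−1)/2}` on the used levels, every family `A` of `t`-cuts with `|A|/C(n,t) ≥ exp(−c₀ dq n)` and every `(PM_n,τ)`-homogeneous `Y` with
`|Y|/|PM_n| ≥ exp(−c₀ dq n)`:  `Σ_{U∈A} Σ_{M∈Y} W(U,M) ≤ B·Γ·√(P_D·μ·ν)`. [cite: KeevashLifshitz2023, Thm. 1.8] [cite: Rothvoss2017, §2 (PDF p. 6)]
[cite: Grigoriev2001, Lemma 1.4 (PDF p. 8)] -/
theorem spreadCell_value_le_half_of_globalLevelD (hKL : GlobalLevelDInequality) {τ : ℝ} (hτ : 1 ≤ τ) :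
    ∃ c₀ : ℝ, 0 < c₀ ∧ c₀ ≤ 1 ∧ ∃ n₁ : ℕ, ∀ (n c' T D : ℕ) (Bv Γ : ℝ) (C : Finset ℕ) (w : ℕ → ℝ), n₁ ≤ n → Even n →
      2 * (2 * c' + 1) ≤ n → n ≤ 5 * (2 * c' + 1) → T ≤ 2 * c' + 1 → D + 2 ≤ 2 * c' → D ≤ 2 * (dq n + 8) →
      (∀ c ∈ C, Odd c ∧ 3 ≤ c ∧ c ≤ T ∧ (Qset n (2 * c' + 1) c).Nonempty) →
      (∀ q : Polynomial ℝ, q.natDegree ≤ D → ∑ c ∈ C, w c * q.eval (c : ℝ) = -q.eval 0) →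
      ∑ c ∈ C, |w c| ≤ Bv → 0 ≤ Γ →
      (∀ m : ℕ, 2 * m + 1 ≤ T →
        (1 + (2 * m * (2 * m + 1) : ℝ) / (4 * (c' - m + 1) * ((n / 2 - c' - m : ℕ) : ℝ))) ^ c' ≤ Γ) →
      ∀ (A : Finset (OddSet n)), (∀ U ∈ A, U.1.card = 2 * c' + 1) →
      ∀ (Y : Finset (PMatch n)), IsRelHomogeneous τ (perfectMatchings (univ : Finset (Fin n))) (Y.image Subtype.val) →
      Real.exp (-(c₀ * dq n)) ≤ (A.card : ℝ) / (n.choose (2 * c' + 1) : ℝ) →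
      Real.exp (-(c₀ * dq n)) ≤ (Y.card : ℝ) / (Fintype.card (PMatch n) : ℝ) →
        ∑ U ∈ A, ∑ M ∈ Y, levelWeight n (2 * c' + 1) C w U M ≤
          Bv * Γ * Real.sqrt ((∏ i ∈ range (D / 2 + 1), ((2 * i + 1 : ℝ) / ((n : ℝ) - 2 * i))) *
            ((A.card : ℝ) / (n.choose (2 * c' + 1) : ℝ)) * ((Y.card : ℝ) / (Fintype.card (PMatch n) : ℝ))) := by
  classical
  obtain ⟨c₀, hc₀, hc₀1, n₁, hvns⟩ := virtual_nonneg_spread_of_globalLevelD hKL hτ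
  refine ⟨c₀, hc₀, hc₀1, n₁, ?_⟩
  intro n c' T D Bv Γ C w hn₁ hn ht hbal hTt hD2 hDq hC hexact hB hΓ0 hΓ A hA Y hhom hμ hν
  -- `A` as a family of `t`-subsets and its harmonic layer decomposition
  set X : Finset (Finset (Fin n)) := A.image Subtype.val with hXdef
  have hX : X ⊆ univ.powersetCard (2 * c' + 1) := by
    intro U hU
    obtain ⟨U', hU', rfl⟩ := mem_image.1 hU
    exact mem_powersetCard_univ.2 (hA U' hU')
  have hcard : (X.card : ℝ) = A.card := by rw [hXdef, card_image_of_injective _ Subtype.val_injective]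
  have hhomog : IsHomog (2 * c' + 1) (fun U : Finset (Fin n) => if U ∈ X then (1 : ℝ) else 0) := by
    intro S hS
    simp only
    rw [if_neg]
    intro hSX
    exact hS (mem_powersetCard.1 (hX hSX)).2
  obtain ⟨p, hp, hpeq⟩ := exists_ladder_decomposition (by omega : 2 * (2 * c' + 1) ≤ n + 1) hhomog
  have hdec : ∀ U ∈ univ.powersetCard (2 * c' + 1),
      (if U ∈ X then (1 : ℝ) else 0) = (∑ j ∈ range (2 * c' + 1 + 1), up^[2 * c' + 1 - j] (p j)) U :=
    fun U _ => congrFun hpeq U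
  have hμ' : Real.exp (-(c₀ * dq n)) ≤ (X.card : ℝ) / (n.choose (2 * c' + 1) : ℝ) := by rw [hcard]; exact hμ
  -- truncation and virtual nonnegativity
  have htrunc := rectangle_value_truncation_half hn ht hTt (by omega) hC hexact hB hΓ0 hΓ X hX Y p hp hdec
  have hv := hvns n c' D hn₁ hn ht hbal hD2 hDq X hX p hp hdec Y hhom hμ' hν
  have hμν0 : 0 ≤ ((X.card : ℝ) / (n.choose (2 * c' + 1) : ℝ)) * ((Y.card : ℝ) / (Fintype.card (PMatch n) : ℝ)) := by
    positivity
  have h1 := (abs_le.1 htrunc).2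
  -- the indicator-weighted sum is the sum over `A`
  have hsum : ∑ U : OddSet n, ∑ M ∈ Y, levelWeight n (2 * c' + 1) C w U M * (if U.1 ∈ X then (1 : ℝ) else 0) =
      ∑ U ∈ A, ∑ M ∈ Y, levelWeight n (2 * c' + 1) C w U M := by
    have hmem : ∀ U : OddSet n, U.1 ∈ X ↔ U ∈ A := by
      intro U
      rw [hXdef, mem_image]
      constructor
      · rintro ⟨U', hU', h⟩; rwa [← Subtype.ext h]
      · intro hU; exact ⟨U, hU, rfl⟩
    rw [← sum_filter_add_sum_filter_not univ (fun U : OddSet n => U ∈ A)]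
    have h0 : ∑ U ∈ univ.filter (fun U : OddSet n => ¬U ∈ A), ∑ M ∈ Y,
        levelWeight n (2 * c' + 1) C w U M * (if U.1 ∈ X then (1 : ℝ) else 0) = 0 :=
      sum_eq_zero fun U hU => by
        have : ¬U.1 ∈ X := fun h => (mem_filter.1 hU).2 ((hmem U).1 h)
        simp [this]
    rw [h0, add_zero, show univ.filter (fun U : OddSet n => U ∈ A) = A by ext U; simp]
    refine sum_congr rfl fun U hU => sum_congr rfl fun M _ => ?_
    rw [if_pos ((hmem U).2 hU), mul_one]
  rw [hsum, hcard] at h1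
  linarith

end Summit.PneNP.PneNP.Theorems.ChebyshevTracialDesignProfileExtrapolationHalf
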